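import Mathlib.LinearAlgebra.Matrix.Determinant.Basic
import Mathlib.LinearAlgebra.Matrix.Permanent
import Mathlib.Algebra.MvPolynomial.Basic
import Mathlib.Algebra.Ring.Int.Units
import Mathlib.GroupTheory.Perm.Fin
import Mathlib.Algebra.Order.BigOperators.Group.Finset
import Mathlib.Algebra.BigOperators.GroupWithZero.Finset
import Mathlib.Algebra.BigOperators.Finsupp.Basic
import Mathlib.Tactic.LinearCombination
import Literature.Combinatorics.SimpleGraph.MatchingMinor
import Literature.Combinatorics.SimpleGraph.PerfectMatchingPoly
import HarnessLib

/-!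
# Pfaffian bipartite graphs (Pólya signings of the biadjacency matrix)

Topic `Combinatorics/SimpleGraph`; definitions + proved API, no named facts. Requested by the
definition item `defn-IsPfaffianBipartite` of route `ValiantsHypothesis/PolyaContinued`, in that
route's encoding (the same as `MatchingMinor.lean`): a bipartite graph with colour classes "rows"
and "columns" both indexed by a finite type `ι` (the route: `ι = Fin m`) is its EDGE SET
`G : Finset (ι × ι)`, the support of its biadjacency matrix; a perfect matching of `G` is a
permutation `σ` of `ι` with `(i, σ i) ∈ G` for all `i`.

The notion, as printed (Robertson–Seymour–Thomas 1999, §1):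

> If `A` is a 0-1 square matrix, under what conditions does there exist a matrix `B` obtained
> from `A` by changing some of the 1's to −1's in such a way that the permanent of `A` equals the
> determinant of `B`? For the purpose of this paper let us say that `B` (when it exists) is a
> *Pólya matrix* for `A`. […] (1.1) [Vazirani–Yannakakis] Let `A` be a 0-1 square matrix, and let
> `G` be the associated bipartite graph. Then `A` has a Pólya matrix if and only if `G` has a
> Pfaffian orientation.

(A *Pfaffian orientation* is one in which every central circuit of even length is oddly
oriented, RST99 §1; bipartite graphs admitting one are called **Pfaffian**, cf. Little 1975,
McCuaig 2004.) Since `det B` is the sum over the perfect matchings `σ` of `G` of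
`sign σ · ∏ᵢ B i (σ i) = ±1` and `per A` counts the perfect matchings, `B` is a Pólya matrix for
`A` exactly when EVERY perfect matching contributes `+1`; this sign condition is the definition
used here (`IsPolyaSigning`), and its equivalence with the printed matrix identity is proved
(`isPolyaSigning_iff_det_eq_permanent`).

## Contents

* `IsPolyaSigning G s` — the signing `s : ι × ι → ℤˣ` makes every perfect matching positive:
  `sign σ * ∏ i, s (i, σ i) = 1`; `IsPfaffianBipartite G` — some signing is a Pólya signing
  (⟺ the biadjacency matrix has a Pólya matrix ⟺ (RST99 (1.1), NOT proved here) `G` has a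
  Pfaffian orientation);
* `isPolyaSigning_iff_det_eq_permanent`, `isPfaffianBipartite_iff_exists_det_eq_permanent` —
  the printed form: `det B = per A` over `ℤ` for the signed / unsigned 0-1 biadjacency matrices;
* `isPfaffianBipartite_iff_exists_mvPolynomial` — the SYMBOLIC form inlined in every item of
  route `PolyaContinued` (there `ι = Fin m`, `R = ℂ`): over a commutative ring with `(2 : R) ≠ 0`,
  `IsPfaffianBipartite G ↔ ∃ s : ι × ι → R, (∀ e, s e = 1 ∨ s e = -1) ∧ det (C (s (i,j)) * X (i,j)
  on G) = per (X (i,j) on G)`, the right-hand side being the perfect-matching polynomial `PM_G`;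
  "Pfaffian ⇒ identity" holds over every commutative ring
  (`IsPolyaSigning.det_eq_permanent_mvPolynomial`);
* small API: anti-monotonicity in `G` (`IsPolyaSigning.anti`, `IsPfaffianBipartite.anti`), the
  global sign is immaterial (`isPfaffianBipartite_of_forall_sign_eq`),
  graphs without perfect matchings are Pfaffian (`isPfaffianBipartite_of_not_hasPerfectMatching`,
  RST99 §9), `K_{2,2}` is Pfaffian (`isPfaffianBipartite_univ_fin_two`) and `K_{3,3}` is not
  (`not_isPfaffianBipartite_univ_fin_three`, RST99 (6.2));
* the Leibniz expansions used (`det_of_ite_mem`, `permanent_of_ite_mem`,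
  `coeff_matchingExponent_sum`, `det_signedSymbolic_eq_sum`, `permanent_symbolic_eq_sum`), kept
  public for the route's provers; the matching monomials `matchingExponent`,
  `matchingExponent_apply`, `matchingExponent_injective`, `prod_X_eq_monomial_matchingExponent`
  are those of `PerfectMatchingPoly.lean` (imported; the first version of this file redeclared
  them under the same names, which made the two modules impossible to import together).

## Design notes / what is NOT here

* The definition is the sign condition on perfect matchings (ring-free, `ℤˣ`-valued signings so
  that `Equiv.Perm.sign σ` multiplies directly); both matrix forms are theorems. Over a ring with
  `2 = 0` every signing satisfies the symbolic identity (per = det), so the hypothesis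
  `(2 : R) ≠ 0` of the "⇐" direction is necessary.
* NOT here: (Pfaffian) orientations of general graphs and RST99 (1.1) (Vazirani–Yannakakis);
  Little's theorem (Pfaffian ⟺ no `K_{3,3}` matching minor, RST99 (1.2)); the RST99/McCuaig
  structure theorem (planar braces, Heawood graph, 4-sums); Kasteleyn's theorem (planar ⇒
  Pfaffian) — the route's later cite requests.
* Mathlib has `Matrix.det`, `Matrix.permanent`, `Equiv.Perm.sign` and nothing on Pfaffian
  orientations or Pólya's problem (`lean search 'faffian.?rient|IsPfaffian|Kasteleyn|convertib'`:
  no declaration).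

## References

* N. Robertson, P. D. Seymour, R. Thomas, *Permanents, Pfaffian orientations, and even directed
  circuits*, Ann. of Math. 150 (1999) 929–975 (arXiv:math/9911268): §1 (Pólya matrix, Pfaffian
  orientation, (1.1), (1.2)), (6.2) (`K_{3,3}`), §9 (no perfect matching ⇒ Pfaffian).
  [RobertsonSeymourThomas1999]
* G. Pólya, *Aufgabe 424*, Arch. Math. Phys. (3) 20 (1913) 271 (RST99 ref. [17]).
* C. H. C. Little, *A characterization of convertible (0,1)-matrices*, J. Combin. Theory Ser. B
  18 (1975) 187–208 (RST99 ref. [9]). [Little1975]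
* V. V. Vazirani, M. Yannakakis, *Pfaffian orientations, 0-1 permanents, and even cycles in
  directed graphs*, Discrete Appl. Math. 25 (1989) 179–190 (RST99 ref. [25], source of (1.1)).
  [VaziraniYannakakis1989]
* W. McCuaig, *Pólya's permanent problem*, Electron. J. Combin. 11 (2004) R79. [McCuaig2004]
-/

namespace Literature.Combinatorics.SimpleGraph

open Finset Equiv

variable {ι : Type*} [Fintype ι] [DecidableEq ι]

/-! ### The definitions -/

/-- **Pólya signing.** For a bipartite graph `G ⊆ ι × ι` (rows × columns, edge-set encoding) and
a `±1`-signing `s` of the entries of its biadjacency matrix: every perfect matching `σ` of `G`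
(a permutation with all `(i, σ i) ∈ G`) is *positive*, `sign σ · ∏ᵢ s (i, σ i) = 1`. Equivalently
(`isPolyaSigning_iff_det_eq_permanent`) the signed 0-1 biadjacency matrix `B = (s ∘ 𝟙_G)` has
`det B = per A`, i.e. `B` is a *Pólya matrix* for the biadjacency matrix `A` of `G` in the sense of
Robertson–Seymour–Thomas.
[cite: RobertsonSeymourThomas1999, §1 (Pólya matrix)] -/
def IsPolyaSigning (G : Finset (ι × ι)) (s : ι × ι → ℤˣ) : Prop :=
  ∀ σ : Equiv.Perm ι, (∀ i, (i, σ i) ∈ G) → Equiv.Perm.sign σ * ∏ i, s (i, σ i) = 1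

/-- **Pfaffian bipartite graph** (edge-set encoding, rows and columns indexed by `ι`): the
biadjacency matrix of `G` admits a Pólya signing — some of its 1's can be changed to −1's so that
the determinant of the signed matrix equals the permanent of the unsigned one
(`isPfaffianBipartite_iff_exists_det_eq_permanent`; symbolic form used by route `PolyaContinued`:
`isPfaffianBipartite_iff_exists_mvPolynomial`). By Robertson–Seymour–Thomas (1.1)
(Vazirani–Yannakakis 1989) this holds iff the bipartite graph has a Pfaffian orientation, whence
the name; that equivalence is not formalised here.
[cite: RobertsonSeymourThomas1999, §1 (Pólya matrix; (1.1))] -/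
def IsPfaffianBipartite (G : Finset (ι × ι)) : Prop :=
  ∃ s : ι × ι → ℤˣ, IsPolyaSigning G s

/-! ### Elementary API -/

/-- A Pólya signing of `G` is a Pólya signing of every subgraph `G' ⊆ G` on the same vertex set
(fewer perfect matchings to check). [folklore] -/
theorem IsPolyaSigning.anti {G G' : Finset (ι × ι)} {s : ι × ι → ℤˣ} (h : IsPolyaSigning G s)
    (hG : G' ⊆ G) : IsPolyaSigning G' s :=
  fun σ hσ => h σ fun i => hG (hσ i)

/-- Subgraphs (same vertex set) of Pfaffian bipartite graphs are Pfaffian. [folklore] -/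
theorem IsPfaffianBipartite.anti {G G' : Finset (ι × ι)} (h : IsPfaffianBipartite G)
    (hG : G' ⊆ G) : IsPfaffianBipartite G' :=
  let ⟨s, hs⟩ := h; ⟨s, hs.anti hG⟩

/-- A bipartite graph without perfect matchings is (vacuously) Pfaffian: every signing is a Pólya
signing (Robertson–Seymour–Thomas 1999, §9: "If `G` has no perfect matching, then every
orientation of `G` is Pfaffian"). [folklore] -/
theorem isPfaffianBipartite_of_forall_exists_not_mem {G : Finset (ι × ι)}
    (h : ∀ σ : Equiv.Perm ι, ∃ i, (i, σ i) ∉ G) : IsPfaffianBipartite G :=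
  ⟨fun _ => 1, fun σ hσ => (h σ).elim fun i hi => absurd (hσ i) hi⟩

/-- `Fin n` version of the preceding, with `HasPerfectMatching` of `MatchingMinor.lean`.
[folklore] -/
theorem isPfaffianBipartite_of_not_hasPerfectMatching {n : ℕ} {G : Finset (Fin n × Fin n)}
    (h : ¬ HasPerfectMatching G) : IsPfaffianBipartite G :=
  isPfaffianBipartite_of_forall_exists_not_mem fun σ => not_forall.mp fun hσ => h ⟨σ, hσ⟩

/-- The edgeless bipartite graph on a nonempty vertex set is Pfaffian. [folklore] -/
theorem isPfaffianBipartite_empty [Nonempty ι] : IsPfaffianBipartite (∅ : Finset (ι × ι)) :=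
  isPfaffianBipartite_of_forall_exists_not_mem fun _ =>
    ⟨Classical.arbitrary ι, Finset.notMem_empty _⟩

/-- **The global sign is immaterial**: if under some signing ALL perfect matchings of `G` have
the same sign `c` (e.g. a signing `B` with `det B = -per A`), then `G` is Pfaffian — multiply one
row of the signing by `c⁻¹`. [folklore] -/
theorem isPfaffianBipartite_of_forall_sign_eq {G : Finset (ι × ι)} (s : ι × ι → ℤˣ) (c : ℤˣ)
    (h : ∀ σ : Equiv.Perm ι, (∀ i, (i, σ i) ∈ G) → Equiv.Perm.sign σ * ∏ i, s (i, σ i) = c) :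
    IsPfaffianBipartite G := by
  cases isEmpty_or_nonempty ι with
  | inl hι =>
    refine ⟨s, fun σ _ => ?_⟩
    have hσ1 : σ = 1 := Equiv.ext fun i => isEmptyElim i
    subst hσ1
    simp
  | inr hι =>
    obtain ⟨i₀⟩ := hι
    refine ⟨fun e => (if e.1 = i₀ then c⁻¹ else 1) * s e, fun σ hσ => ?_⟩
    show Equiv.Perm.sign σ * ∏ i, ((if i = i₀ then c⁻¹ else 1) * s (i, σ i)) = 1
    rw [Finset.prod_mul_distrib, Finset.prod_ite_eq' Finset.univ i₀ fun _ => c⁻¹,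
      if_pos (Finset.mem_univ _), mul_left_comm, h σ hσ, inv_mul_cancel]

/-! ### Leibniz expansions for matrices supported on `G` (row convention) -/

/-- Row-convention Leibniz expansion of the determinant of a matrix supported on `G`: only the
perfect matchings of `G` contribute. [folklore] -/
theorem det_of_ite_mem {S : Type*} [CommRing S] (G : Finset (ι × ι)) (f : ι → ι → S) :
    (Matrix.of fun i j => if (i, j) ∈ G then f i j else 0).det =
      ∑ σ : Equiv.Perm ι, if (∀ i, (i, σ i) ∈ G) then
        ((Equiv.Perm.sign σ : ℤ) : S) * ∏ i, f i (σ i) else 0 := by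
  rw [← Matrix.det_transpose, Matrix.det_apply']
  refine Finset.sum_congr rfl fun σ _ => ?_
  simp only [Matrix.transpose_apply, Matrix.of_apply]
  rw [Fintype.prod_ite_zero, mul_ite, mul_zero]

/-- Row-convention expansion of the permanent of a matrix supported on `G`: only the perfect
matchings of `G` contribute. [folklore] -/
theorem permanent_of_ite_mem {S : Type*} [CommSemiring S] (G : Finset (ι × ι)) (f : ι → ι → S) :
    (Matrix.of fun i j => if (i, j) ∈ G then f i j else 0).permanent =
      ∑ σ : Equiv.Perm ι, if (∀ i, (i, σ i) ∈ G) then ∏ i, f i (σ i) else 0 := by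
  rw [← Matrix.permanent_transpose, Matrix.permanent]
  refine Finset.sum_congr rfl fun σ _ => ?_
  simp only [Matrix.transpose_apply, Matrix.of_apply]
  rw [Fintype.prod_ite_zero]

/-! ### The printed form: Pólya matrices (`det B = per A` over `ℤ`) -/

/-- **Pólya's permanent problem, matrix form.** A signing `s` is a Pólya signing of `G` iff the
signed 0-1 biadjacency matrix `B` (entries `s (i,j)` on `G`, `0` elsewhere) satisfies
`det B = per A`, `A` the 0-1 biadjacency matrix of `G` — the definition printed in
Robertson–Seymour–Thomas 1999, §1 ("changing some of the 1's to −1's in such a way that the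
permanent of `A` equals the determinant of `B`"). Proof: `det B = ∑_{σ ⊆ G} ±1` termwise
`≤ per A = ∑_{σ ⊆ G} 1`, with equality iff every term is `+1`.
[cite: RobertsonSeymourThomas1999, §1 (Pólya matrix)] -/
theorem isPolyaSigning_iff_det_eq_permanent (G : Finset (ι × ι)) (s : ι × ι → ℤˣ) :
    IsPolyaSigning G s ↔
      (Matrix.of fun i j => if (i, j) ∈ G then ((s (i, j) : ℤˣ) : ℤ) else 0).det =
        (Matrix.of fun i j => if (i, j) ∈ G then (1 : ℤ) else 0).permanent := by
  rw [det_of_ite_mem, permanent_of_ite_mem]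
  simp only [Finset.prod_const_one, Int.cast_id]
  have hle : ∀ σ ∈ (Finset.univ : Finset (Equiv.Perm ι)),
      (if (∀ i, (i, σ i) ∈ G) then (Equiv.Perm.sign σ : ℤ) * ∏ i, ((s (i, σ i) : ℤˣ) : ℤ)
        else 0) ≤ (if (∀ i, (i, σ i) ∈ G) then (1 : ℤ) else 0) := by
    intro σ _
    split_ifs
    · rw [← Units.coe_prod, ← Units.val_mul]
      rcases Int.units_eq_one_or (Equiv.Perm.sign σ * ∏ i, s (i, σ i)) with h | h <;> simp [h]
    · exact le_rfl
  rw [Finset.sum_eq_sum_iff_of_le hle]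
  constructor
  · intro h σ _
    by_cases hσ : ∀ i, (i, σ i) ∈ G
    · rw [if_pos hσ, if_pos hσ, ← Units.coe_prod, ← Units.val_mul, h σ hσ, Units.val_one]
    · rw [if_neg hσ, if_neg hσ]
  · intro h σ hσ
    have hσ' := h σ (Finset.mem_univ σ)
    rw [if_pos hσ, if_pos hσ, ← Units.coe_prod, ← Units.val_mul, Units.val_eq_one] at hσ'
    exact hσ'

/-- `G` is Pfaffian iff its 0-1 biadjacency matrix `A` has a Pólya matrix: a `±1`-signing `B` of
`A` with `det B = per A` (Robertson–Seymour–Thomas 1999, §1).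
[cite: RobertsonSeymourThomas1999, §1 (Pólya matrix)] -/
theorem isPfaffianBipartite_iff_exists_det_eq_permanent (G : Finset (ι × ι)) :
    IsPfaffianBipartite G ↔ ∃ s : ι × ι → ℤˣ,
      (Matrix.of fun i j => if (i, j) ∈ G then ((s (i, j) : ℤˣ) : ℤ) else 0).det =
        (Matrix.of fun i j => if (i, j) ∈ G then (1 : ℤ) else 0).permanent :=
  exists_congr fun s => isPolyaSigning_iff_det_eq_permanent G s

/-! ### The symbolic form: `det` of the signed symbolic biadjacency matrix `=` the
perfect-matching polynomial -/

/-- Coefficient extraction: in a sum of matching monomials, the coefficient of the matching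
monomial of `τ` is the `τ`-th coefficient. [folklore] -/
theorem coeff_matchingExponent_sum {R : Type*} [CommSemiring R] (p : Equiv.Perm ι → Prop)
    [DecidablePred p] (c : Equiv.Perm ι → R) (τ : Equiv.Perm ι) :
    MvPolynomial.coeff (matchingExponent τ)
        (∑ σ : Equiv.Perm ι, if p σ then MvPolynomial.monomial (matchingExponent σ) (c σ) else 0) =
      if p τ then c τ else 0 := by
  rw [MvPolynomial.coeff_sum, Finset.sum_eq_single τ]
  · split_ifs <;> simp
  · intro σ _ hσ
    split_ifs
    · rw [MvPolynomial.coeff_monomial, if_neg fun h => hσ (matchingExponent_injective h)]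
    · simp
  · exact fun h => absurd (Finset.mem_univ τ) h

/-- Expansion of `det` of a signed symbolic biadjacency matrix `(C (s i j) * X (i,j))_{(i,j) ∈ G}`
in matching monomials (curried `s`, so that `rw` also matches composed signings such as
`C (((s (i, j) : ℤˣ) : ℤ) : R)`). [folklore] -/
theorem det_signedSymbolic_eq_sum {R : Type*} [CommRing R] (G : Finset (ι × ι)) (s : ι → ι → R) :
    (Matrix.of fun i j => if (i, j) ∈ G then MvPolynomial.C (s i j) * MvPolynomial.X (i, j)
        else 0 : Matrix ι ι (MvPolynomial (ι × ι) R)).det =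
      ∑ σ : Equiv.Perm ι, if (∀ i, (i, σ i) ∈ G) then
        MvPolynomial.monomial (matchingExponent σ)
          (((Equiv.Perm.sign σ : ℤ) : R) * ∏ i, s i (σ i)) else 0 := by
  rw [det_of_ite_mem]
  refine Finset.sum_congr rfl fun σ _ => ?_
  split_ifs with h
  · rw [Finset.prod_mul_distrib, ← map_prod MvPolynomial.C, prod_X_eq_monomial_matchingExponent,
      ← map_intCast (MvPolynomial.C : R →+* MvPolynomial (ι × ι) R), MvPolynomial.C_mul_monomial,
      MvPolynomial.C_mul_monomial, mul_one]
  · rfl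

/-- Expansion of the perfect-matching polynomial `per (X (i,j))_{(i,j) ∈ G}` in matching
monomials. [folklore] -/
theorem permanent_symbolic_eq_sum {R : Type*} [CommSemiring R] (G : Finset (ι × ι)) :
    (Matrix.of fun i j => if (i, j) ∈ G then MvPolynomial.X (i, j)
        else 0 : Matrix ι ι (MvPolynomial (ι × ι) R)).permanent =
      ∑ σ : Equiv.Perm ι, if (∀ i, (i, σ i) ∈ G) then
        MvPolynomial.monomial (matchingExponent σ) (1 : R) else 0 := by
  rw [permanent_of_ite_mem]
  refine Finset.sum_congr rfl fun σ _ => ?_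
  split_ifs
  · exact prod_X_eq_monomial_matchingExponent R σ
  · rfl

/-- **Pfaffian ⇒ the symbolic identity**, over every commutative ring: a Pólya signing `s`, cast
into `R`, makes `det` of the signed symbolic biadjacency matrix equal to the perfect-matching
polynomial (Kasteleyn's use of Pfaffian orientations). [folklore] -/
theorem IsPolyaSigning.det_eq_permanent_mvPolynomial {R : Type*} [CommRing R] {G : Finset (ι × ι)}
    {s : ι × ι → ℤˣ} (h : IsPolyaSigning G s) :
    (Matrix.of fun i j => if (i, j) ∈ G then
        MvPolynomial.C (((s (i, j) : ℤˣ) : ℤ) : R) * MvPolynomial.X (i, j)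
        else 0 : Matrix ι ι (MvPolynomial (ι × ι) R)).det =
      (Matrix.of fun i j => if (i, j) ∈ G then MvPolynomial.X (i, j)
        else 0 : Matrix ι ι (MvPolynomial (ι × ι) R)).permanent := by
  rw [det_signedSymbolic_eq_sum, permanent_symbolic_eq_sum]
  refine Finset.sum_congr rfl fun σ _ => ?_
  split_ifs with hσ
  · congr 1
    rw [← Int.cast_prod, ← Int.cast_mul, ← Units.coe_prod, ← Units.val_mul, h σ hσ, Units.val_one,
      Int.cast_one]
  · rfl

/-- **The symbolic form of Pfaffian-ness** (the conjunct inlined in every item of route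
`ValiantsHypothesis/PolyaContinued`, there with `ι = Fin m`, `R = ℂ`): over a commutative ring in
which `2 ≠ 0`, `G` is Pfaffian iff some `±1`-valued `s : ι × ι → R` makes the determinant of the
signed symbolic biadjacency matrix `(C (s (i,j)) * X (i,j))_{(i,j) ∈ G}` equal to the permanent of
the symbolic biadjacency matrix `(X (i,j))_{(i,j) ∈ G}`, i.e. to the perfect-matching polynomial
`PM_G`. ("⇐" compares the coefficients of the matching monomials and needs `-1 ≠ 1` in `R`; in
characteristic `2` the right-hand side holds for every `G`.) [folklore] -/
theorem isPfaffianBipartite_iff_exists_mvPolynomial {R : Type*} [CommRing R] (G : Finset (ι × ι))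
    (h2 : (2 : R) ≠ 0) :
    IsPfaffianBipartite G ↔ ∃ s : ι × ι → R, (∀ e, s e = 1 ∨ s e = -1) ∧
      (Matrix.of fun i j => if (i, j) ∈ G then MvPolynomial.C (s (i, j)) * MvPolynomial.X (i, j)
        else 0 : Matrix ι ι (MvPolynomial (ι × ι) R)).det =
      (Matrix.of fun i j => if (i, j) ∈ G then MvPolynomial.X (i, j)
        else 0 : Matrix ι ι (MvPolynomial (ι × ι) R)).permanent := by
  constructor
  · rintro ⟨s, hs⟩
    refine ⟨fun e => (((s e : ℤˣ) : ℤ) : R), fun e => ?_, hs.det_eq_permanent_mvPolynomial⟩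
    rcases Int.units_eq_one_or (s e) with h | h <;> simp [h]
  · rintro ⟨s, hs1, hdet⟩
    classical
    have hne : (-1 : R) ≠ 1 := fun h1 => h2 (by linear_combination -h1)
    obtain ⟨s₀, hs₀⟩ : ∃ s₀ : ι × ι → ℤˣ, ∀ e, (((s₀ e : ℤˣ) : ℤ) : R) = s e := by
      refine ⟨fun e => if s e = 1 then 1 else -1, fun e => ?_⟩
      dsimp only
      rcases hs1 e with h | h
      · simp [h]
      · rw [h, if_neg hne]
        simp
    refine ⟨s₀, fun τ hτ => ?_⟩
    have key := congrArg (MvPolynomial.coeff (matchingExponent τ)) hdet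
    rw [det_signedSymbolic_eq_sum, permanent_symbolic_eq_sum, coeff_matchingExponent_sum,
      coeff_matchingExponent_sum, if_pos hτ, if_pos hτ] at key
    have hu : (((Equiv.Perm.sign τ * ∏ i, s₀ (i, τ i) : ℤˣ) : ℤ) : R) = 1 := by
      rw [Units.val_mul, Int.cast_mul, Units.coe_prod, Int.cast_prod]
      refine Eq.trans ?_ key
      exact congrArg _ (Finset.prod_congr rfl fun i _ => hs₀ _)
    rcases Int.units_eq_one_or (Equiv.Perm.sign τ * ∏ i, s₀ (i, τ i)) with h | h
    · exact h
    · rw [h, Units.val_neg, Units.val_one, Int.cast_neg, Int.cast_one] at hu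
      exact absurd hu hne

/-! ### Examples: `K_{2,2}` is Pfaffian, `K_{3,3}` is not -/

/-- **`K_{2,2}` (the 4-cycle) is Pfaffian**: sign the entry `(0, 1)`, i.e.
`B = !![1, -1; 1, 1]`, `det B = 2 = per A`. [folklore] -/
theorem isPfaffianBipartite_univ_fin_two :
    IsPfaffianBipartite (Finset.univ : Finset (Fin 2 × Fin 2)) := by
  refine ⟨fun e => if e = (0, 1) then -1 else 1, fun σ _ => ?_⟩
  -- a permutation of `Fin 2` is the identity or the transposition
  -- (cf. `Literature.Geometry.Kaehler.Zucker.perm_fin_two`, not imported here)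
  have hσ : σ = 1 ∨ σ = swap 0 1 := by
    have h01 : ∀ x : Fin 2, x = 0 ∨ x = 1 := by decide
    have hinj : σ 0 ≠ σ 1 := fun h => absurd (σ.injective h) (by decide)
    rcases h01 (σ 0) with h0 | h0 <;> rcases h01 (σ 1) with h1 | h1
    · exact absurd (h0.trans h1.symm) hinj
    · left; ext x; rcases h01 x with rfl | rfl <;> simp [h0, h1]
    · right; ext x; rcases h01 x with rfl | rfl <;> simp [h0, h1]
    · exact absurd (h0.trans h1.symm) hinj
  rcases hσ with rfl | rfl
  · simp [Fin.prod_univ_two]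
  · simp [Fin.prod_univ_two, Equiv.swap_apply_def]

/-- **`K_{3,3}` is not Pfaffian** (Pólya 1913: no signing converts the `3 × 3` permanent into a
determinant; Robertson–Seymour–Thomas 1999, (6.2)). Proof: under a Pólya signing the three even
permutations of `S₃` would be positive and the three odd ones negative, but both triples of
terms multiply to the product of all nine signs. [cite: RobertsonSeymourThomas1999, (6.2)] -/
theorem not_isPfaffianBipartite_univ_fin_three :
    ¬ IsPfaffianBipartite (Finset.univ : Finset (Fin 3 × Fin 3)) := by
  rintro ⟨s, hs⟩
  have h : ∀ σ : Equiv.Perm (Fin 3), Equiv.Perm.sign σ * ∏ i, s (i, σ i) = 1 :=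
    fun σ => hs σ fun _ => Finset.mem_univ _
  have e1 := h 1; have c1 := h (swap 0 1 * swap 1 2); have c2 := h (swap 1 2 * swap 0 1)
  have t01 := h (swap 0 1); have t02 := h (swap 0 2); have t12 := h (swap 1 2)
  simp [Fin.prod_univ_three, Equiv.swap_apply_def] at e1 c1 c2 t01 t02 t12
  rw [neg_eq_iff_eq_neg] at t01 t02 t12  -- even terms `= 1`, odd terms `= -1`
  have key : s (0, 0) * s (1, 1) * s (2, 2) * (s (0, 1) * s (1, 2) * s (2, 0)) *
      (s (0, 2) * s (1, 0) * s (2, 1)) =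
      s (0, 1) * s (1, 0) * s (2, 2) * (s (0, 2) * s (1, 1) * s (2, 0)) *
      (s (0, 0) * s (1, 2) * s (2, 1)) := by ac_rfl
  rw [e1, c1, c2, t01, t02, t12] at key
  exact absurd key (by decide)

end Literature.Combinatorics.SimpleGraph
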